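import Mathlib
import HarnessLib

/-!
# Pencil rigidity / shell rigidity — the radial lift (stub `stub_radialLift`)

Line `transverse-smearing-planar-threshold` of the crux `PencilRigidity.ShellRigidity`
(stmt-QuantumFields-11685).  A kernel `K : ℝ⁴ → ℝ`, continuous off the origin and invariant under
the signed permutation matrices `W(B₄)`, all of whose transverse autocorrelation smearings
`F_h(t,s) = ∫∫ h(w) h(w') K(t,s,w-w') dw dw'` (`h ∈ C_c(ℝ²)`) take equal values at planar points
of equal radius, is invariant under every linear isometry of `ℝ⁴`.

* POLARISATION (`RadialLift.polarisation`): a continuous even kernel `D` on `ℝ²` whose quadratic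
  smearing form `g ↦ ∫∫ g(w) g(w') D(w-w')` vanishes on `C_c(ℝ²)` vanishes identically (the form is
  symmetric by Fubini and evenness, hence its polar form vanishes; then test against bumps twice,
  `ae_eq_zero_of_integral_contDiff_smul_eq_zero` and continuity).  Applied to
  `D(z) = K(y,z) - K(x,z)` for planar `x ≠ 0`, `y` of equal radius (`RadialLift.planar_of_smear`).
* NORM REDUCTION (`RadialLift.norm_reduction`): equal-radius moves in the `(0,1)` coordinate plane,
  conjugated by the coordinate transpositions `(1 2)`, `(1 3) ∈ W(B₄)`, bring every `v` to `‖v‖ e₀`.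

Mathlib only; no positivity and no bounds on `K` are used.
-/

noncomputable section

namespace Summit.QuantumFields.YangMills.Cruxes.ShellRigidity.TransverseSmearingPlanarThreshold

open MeasureTheory

namespace RadialLift

/-! ### Analysis on the transverse plane `ℝ × ℝ` -/

/-- A continuous function on `ℝ × ℝ` whose integral against every continuous compactly supported
test function vanishes is identically zero. -/
theorem eq_zero_of_forall_integral_mul_eq_zero (Φ : ℝ × ℝ → ℝ) (hΦ : Continuous Φ)
    (h : ∀ f : ℝ × ℝ → ℝ, Continuous f → HasCompactSupport f → ∫ w, f w * Φ w = 0) :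
    Φ = 0 := by
  have hae : ∀ᵐ w ∂(volume : Measure (ℝ × ℝ)), Φ w = 0 :=
    ae_eq_zero_of_integral_contDiff_smul_eq_zero hΦ.locallyIntegrable
      fun g hg hgs => by simpa only [smul_eq_mul] using h g hg.continuous hgs
  exact (hΦ.ae_eq_iff_eq volume continuous_zero).1 hae

/-- The smear `w ↦ ∫ g(w') D(w - w') dw'` of a continuous kernel against a continuous compactly
supported test function is continuous. -/
theorem continuous_smear (D : ℝ × ℝ → ℝ) (hD : Continuous D) (g : ℝ × ℝ → ℝ)
    (hg : Continuous g) (hgs : HasCompactSupport g) :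
    Continuous fun w : ℝ × ℝ => ∫ w', g w' * D (w - w') := by
  have hk : IsCompact (tsupport g) := hgs
  have heq : (fun w : ℝ × ℝ => ∫ w', g w' * D (w - w')) =
      fun w => ∫ w' in tsupport g, g w' * D (w - w') := by
    funext w
    refine (setIntegral_eq_integral_of_forall_compl_eq_zero fun w' hw' => ?_).symm
    rw [image_eq_zero_of_notMem_tsupport hw', zero_mul]
  rw [heq]
  exact continuous_parametric_integral_of_continuous (f := fun w w' => g w' * D (w - w'))
    ((hg.comp continuous_snd).mul (hD.comp (continuous_fst.sub continuous_snd))) hk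

/-- Integrability of the inner smearing integrand. -/
theorem integrable_inner (D : ℝ × ℝ → ℝ) (hD : Continuous D) (g : ℝ × ℝ → ℝ)
    (hg : Continuous g) (hgs : HasCompactSupport g) (c : ℝ) (w : ℝ × ℝ) :
    Integrable fun w' : ℝ × ℝ => c * g w' * D (w - w') := by
  refine Continuous.integrable_of_hasCompactSupport (by fun_prop) ?_
  exact (hgs.mul_left (f := fun _ => c)).mul_right (f' := fun w' => D (w - w'))

/-- The inner smearing integral is linear in the outer test-function value. -/
theorem integral_inner_eq (D g : ℝ × ℝ → ℝ) (c : ℝ) (w : ℝ × ℝ) :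
    ∫ w', c * g w' * D (w - w') = c * ∫ w', g w' * D (w - w') := by
  rw [← integral_const_mul]
  congr 1
  funext w'
  ring

/-- Integrability of the outer smearing integrand. -/
theorem integrable_outer (D : ℝ × ℝ → ℝ) (hD : Continuous D) (f g : ℝ × ℝ → ℝ)
    (hf : Continuous f) (hfs : HasCompactSupport f) (hg : Continuous g)
    (hgs : HasCompactSupport g) :
    Integrable fun w : ℝ × ℝ => ∫ w', f w * g w' * D (w - w') := by
  have heq : (fun w : ℝ × ℝ => ∫ w', f w * g w' * D (w - w')) =
      fun w => f w * ∫ w', g w' * D (w - w') :=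
    funext fun w => integral_inner_eq D g (f w) w
  rw [heq]
  exact (hf.mul (continuous_smear D hD g hg hgs)).integrable_of_hasCompactSupport
    (hfs.mul_right (f' := fun w => ∫ w', g w' * D (w - w')))

/-- Integrability of the full smearing integrand on the product. -/
theorem integrable_prod (D : ℝ × ℝ → ℝ) (hD : Continuous D) (f g : ℝ × ℝ → ℝ)
    (hf : Continuous f) (hfs : HasCompactSupport f) (hg : Continuous g)
    (hgs : HasCompactSupport g) :
    Integrable (Function.uncurry fun w w' : ℝ × ℝ => f w * g w' * D (w - w'))
      ((volume : Measure (ℝ × ℝ)).prod volume) := by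
  apply Continuous.integrable_of_hasCompactSupport
  · exact ((hf.comp continuous_fst).mul (hg.comp continuous_snd)).mul
      (hD.comp (continuous_fst.sub continuous_snd))
  · refine HasCompactSupport.intro (hfs.prod hgs) ?_
    rintro ⟨w, w'⟩ hp
    rcases not_and_or.1 (fun h => hp (Set.mk_mem_prod h.1 h.2)) with h | h
    · simp [Function.uncurry, image_eq_zero_of_notMem_tsupport h]
    · simp [Function.uncurry, image_eq_zero_of_notMem_tsupport h]

/-- **Polarisation.** A continuous even kernel on `ℝ²` whose quadratic smearing form vanishes on
all continuous compactly supported test functions vanishes identically. -/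
theorem polarisation (D : ℝ × ℝ → ℝ) (hD : Continuous D) (heven : ∀ z, D (-z) = D z)
    (hQ : ∀ g : ℝ × ℝ → ℝ, Continuous g → HasCompactSupport g →
      ∫ w, ∫ w', g w * g w' * D (w - w') = 0) :
    D = 0 := by
  -- the bilinear form factors through the smear
  have hB : ∀ f g : ℝ × ℝ → ℝ,
      ∫ w, ∫ w', f w * g w' * D (w - w') = ∫ w, f w * ∫ w', g w' * D (w - w') := by
    intro f g
    congr 1
    funext w
    exact integral_inner_eq D g (f w) w
  -- symmetry of the bilinear form (Fubini + evenness)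
  have hsymm : ∀ f g : ℝ × ℝ → ℝ, Continuous f → HasCompactSupport f → Continuous g →
      HasCompactSupport g →
      ∫ w, ∫ w', f w * g w' * D (w - w') = ∫ w, ∫ w', g w * f w' * D (w - w') := by
    intro f g hf hfs hg hgs
    rw [integral_integral_swap (integrable_prod D hD f g hf hfs hg hgs)]
    congr 1
    funext w
    congr 1
    funext w'
    rw [← heven (w' - w), neg_sub]
    ring
  -- additivity of the inner integral in the test function
  have hadd : ∀ f g : ℝ × ℝ → ℝ, Continuous f → HasCompactSupport f → Continuous g →
      HasCompactSupport g → ∀ (c : ℝ) (w : ℝ × ℝ),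
      ∫ w', c * (f + g) w' * D (w - w') =
        (∫ w', c * f w' * D (w - w')) + ∫ w', c * g w' * D (w - w') := by
    intro f g hf hfs hg hgs c w
    rw [← integral_add (integrable_inner D hD f hf hfs c w) (integrable_inner D hD g hg hgs c w)]
    congr 1
    funext w'
    simp only [Pi.add_apply]
    ring
  -- the polar form vanishes
  have hpolar : ∀ f g : ℝ × ℝ → ℝ, Continuous f → HasCompactSupport f → Continuous g →
      HasCompactSupport g → ∫ w, ∫ w', f w * g w' * D (w - w') = 0 := by
    intro f g hf hfs hg hgs
    have hfg : Continuous (f + g) := hf.add hg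
    have hfgs : HasCompactSupport (f + g) := hfs.add hgs
    have hsum := hQ (f + g) hfg hfgs
    have hsplit : ∀ w, ∫ w', (f + g) w * (f + g) w' * D (w - w') =
        ((∫ w', f w * f w' * D (w - w')) + ∫ w', f w * g w' * D (w - w')) +
          ((∫ w', g w * f w' * D (w - w')) + ∫ w', g w * g w' * D (w - w')) := by
      intro w
      rw [hadd f g hf hfs hg hgs ((f + g) w) w]
      simp only [Pi.add_apply]
      have e1 : ∀ h : ℝ × ℝ → ℝ, (∫ w', (f w + g w) * h w' * D (w - w')) =
          (∫ w', f w * h w' * D (w - w')) + ∫ w', g w * h w' * D (w - w') := by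
        intro h
        rw [integral_inner_eq D h (f w + g w) w, integral_inner_eq D h (f w) w,
          integral_inner_eq D h (g w) w]
        ring
      rw [e1 f, e1 g]
      ring
    have i1 : Integrable fun w : ℝ × ℝ =>
        (∫ w', f w * f w' * D (w - w')) + ∫ w', f w * g w' * D (w - w') :=
      (integrable_outer D hD f f hf hfs hf hfs).add (integrable_outer D hD f g hf hfs hg hgs)
    have i2 : Integrable fun w : ℝ × ℝ =>
        (∫ w', g w * f w' * D (w - w')) + ∫ w', g w * g w' * D (w - w') :=
      (integrable_outer D hD g f hg hgs hf hfs).add (integrable_outer D hD g g hg hgs hg hgs)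
    rw [integral_congr_ae (Filter.Eventually.of_forall hsplit), integral_add i1 i2,
      integral_add (integrable_outer D hD f f hf hfs hf hfs)
        (integrable_outer D hD f g hf hfs hg hgs),
      integral_add (integrable_outer D hD g f hg hgs hf hfs)
        (integrable_outer D hD g g hg hgs hg hgs),
      hQ f hf hfs, hQ g hg hgs, hsymm g f hg hgs hf hfs] at hsum
    linarith
  -- hence every smear vanishes identically
  have hsmear : ∀ g : ℝ × ℝ → ℝ, Continuous g → HasCompactSupport g →
      (fun w => ∫ w', g w' * D (w - w')) = 0 := by
    intro g hg hgs
    refine eq_zero_of_forall_integral_mul_eq_zero _ (continuous_smear D hD g hg hgs) ?_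
    intro f hf hfs
    rw [← hB]
    exact hpolar f g hf hfs hg hgs
  -- evaluate the smear at the origin and use evenness
  refine eq_zero_of_forall_integral_mul_eq_zero D hD fun g hg hgs => ?_
  have h0 := congrFun (hsmear g hg hgs) 0
  simp only [zero_sub, heven, Pi.zero_apply] at h0
  exact h0

/-! ### Coordinates and signed permutations of `ℝ⁴` -/

/-- Coordinate transpositions are signed permutation matrices. -/
theorem isSignedPerm_perm (e : Fin 4 ≃ Fin 4) :
    ∀ i : Fin 4, ∃ j : Fin 4,
      LinearIsometryEquiv.piLpCongrLeft 2 ℝ ℝ e (EuclideanSpace.single i 1) =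
          EuclideanSpace.single j 1 ∨
        LinearIsometryEquiv.piLpCongrLeft 2 ℝ ℝ e (EuclideanSpace.single i 1) =
          -EuclideanSpace.single j 1 :=
  fun i => ⟨e i, Or.inl (EuclideanSpace.piLpCongrLeft_single e i 1)⟩

/-- Coordinates of a permuted vector. -/
theorem perm_apply (e : Fin 4 ≃ Fin 4) (x : EuclideanSpace ℝ (Fin 4)) (i : Fin 4) :
    LinearIsometryEquiv.piLpCongrLeft 2 ℝ ℝ e x i = x (e.symm i) := by
  simp only [LinearIsometryEquiv.piLpCongrLeft_apply, Equiv.piCongrLeft'_apply]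

/-- The sign flip of the two transverse coordinates is a signed permutation matrix sending
`(a, b, c, d)` to `(a, b, -c, -d)`. -/
theorem exists_flip23 :
    ∃ R : EuclideanSpace ℝ (Fin 4) ≃ₗᵢ[ℝ] EuclideanSpace ℝ (Fin 4),
      (∀ i : Fin 4, ∃ j : Fin 4, R (EuclideanSpace.single i 1) = EuclideanSpace.single j 1 ∨
        R (EuclideanSpace.single i 1) = -EuclideanSpace.single j 1) ∧
      ∀ a b c d : ℝ, R (WithLp.toLp 2 ![a, b, c, d]) = WithLp.toLp 2 ![a, b, -c, -d] := by
  refine ⟨LinearIsometryEquiv.piLpCongrRight 2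
    (![LinearIsometryEquiv.refl ℝ ℝ, LinearIsometryEquiv.refl ℝ ℝ, LinearIsometryEquiv.neg ℝ,
      LinearIsometryEquiv.neg ℝ] : Fin 4 → (ℝ ≃ₗᵢ[ℝ] ℝ)), ?_, ?_⟩
  · intro i
    refine ⟨i, ?_⟩
    fin_cases i
    · left; simp
    · left; simp
    · right; simp [PiLp.single_neg]
    · right; simp [PiLp.single_neg]
  · intro a b c d
    ext i
    fin_cases i <;> simp

end RadialLift

open RadialLift in
/-- **Planar equal-radius moves.** For planar `x ≠ 0` and `y` of the same radius,
`K (y, z) = K (x, z)` for every transverse offset `z` (polarisation of the radial smears). -/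
theorem RadialLift.planar_of_smear (K : EuclideanSpace ℝ (Fin 4) → ℝ)
    (hc : ContinuousOn K {x | x ≠ 0})
    (hflip : ∀ a b c d : ℝ,
      K (WithLp.toLp 2 ![a, b, -c, -d]) = K (WithLp.toLp 2 ![a, b, c, d]))
    (hrad : ∀ h : ℝ × ℝ → ℝ, Continuous h → HasCompactSupport h →
      ∀ x y : ℝ × ℝ, x ≠ 0 → x.1 ^ 2 + x.2 ^ 2 = y.1 ^ 2 + y.2 ^ 2 →
        (∫ w : ℝ × ℝ, ∫ w' : ℝ × ℝ,
            h w * h w' * K (WithLp.toLp 2 ![x.1, x.2, (w - w').1, (w - w').2])) =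
          ∫ w : ℝ × ℝ, ∫ w' : ℝ × ℝ,
            h w * h w' * K (WithLp.toLp 2 ![y.1, y.2, (w - w').1, (w - w').2]))
    (x y : ℝ × ℝ) (hx : x ≠ 0) (hxy : x.1 ^ 2 + x.2 ^ 2 = y.1 ^ 2 + y.2 ^ 2) (z : ℝ × ℝ) :
    K (WithLp.toLp 2 ![y.1, y.2, z.1, z.2]) = K (WithLp.toLp 2 ![x.1, x.2, z.1, z.2]) := by
  -- continuity of the planar slices
  have hslice : ∀ p : ℝ × ℝ, p ≠ 0 →
      Continuous fun z : ℝ × ℝ =>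
        K (WithLp.toLp 2 ![p.1, p.2, z.1, z.2] : EuclideanSpace ℝ (Fin 4)) := by
    intro p hp
    have hcont : Continuous fun z : ℝ × ℝ =>
        (WithLp.toLp 2 ![p.1, p.2, z.1, z.2] : EuclideanSpace ℝ (Fin 4)) := by
      fun_prop
    refine hc.comp_continuous hcont fun z => ?_
    simp only [ne_eq, Set.mem_setOf_eq]
    intro h
    apply hp
    have h0 := congrArg (fun v : EuclideanSpace ℝ (Fin 4) => v 0) h
    have h1 := congrArg (fun v : EuclideanSpace ℝ (Fin 4) => v 1) h
    simp only [Matrix.cons_val_zero, Matrix.cons_val_one, PiLp.zero_apply] at h0 h1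
    exact Prod.ext h0 h1
  have hy : y ≠ 0 := by
    rintro rfl
    apply hx
    simp only [Prod.fst_zero, Prod.snd_zero, ne_eq, OfNat.ofNat_ne_zero, not_false_eq_true,
      zero_pow, add_zero] at hxy
    have h1 : x.1 = 0 := by nlinarith [sq_nonneg x.1, sq_nonneg x.2]
    have h2 : x.2 = 0 := by nlinarith [sq_nonneg x.1, sq_nonneg x.2]
    exact Prod.ext h1 h2
  set kx : ℝ × ℝ → ℝ := fun z => K (WithLp.toLp 2 ![x.1, x.2, z.1, z.2]) with hkx_def
  set ky : ℝ × ℝ → ℝ := fun z => K (WithLp.toLp 2 ![y.1, y.2, z.1, z.2]) with hky_def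
  have hkx : Continuous kx := hslice x hx
  have hky : Continuous ky := hslice y hy
  have hr : ∀ g : ℝ × ℝ → ℝ, Continuous g → HasCompactSupport g →
      ∫ w, ∫ w', g w * g w' * kx (w - w') = ∫ w, ∫ w', g w * g w' * ky (w - w') :=
    fun g hg hgs => hrad g hg hgs x y hx hxy
  -- the difference kernel
  have hDc : Continuous fun z => ky z - kx z := hky.sub hkx
  have hDeven : ∀ z, ky (-z) - kx (-z) = ky z - kx z := by
    intro z
    simp only [hkx_def, hky_def, Prod.fst_neg, Prod.snd_neg, hflip]
  have hQ : ∀ g : ℝ × ℝ → ℝ, Continuous g → HasCompactSupport g →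
      ∫ w, ∫ w', g w * g w' * (ky (w - w') - kx (w - w')) = 0 := by
    intro g hg hgs
    have h1 : ∀ w, ∫ w', g w * g w' * (ky (w - w') - kx (w - w')) =
        (∫ w', g w * g w' * ky (w - w')) - ∫ w', g w * g w' * kx (w - w') := by
      intro w
      rw [← integral_sub (integrable_inner ky hky g hg hgs (g w) w)
        (integrable_inner kx hkx g hg hgs (g w) w)]
      congr 1
      funext w'
      ring
    rw [integral_congr_ae (Filter.Eventually.of_forall h1),
      integral_sub (integrable_outer ky hky g g hg hgs hg hgs)
        (integrable_outer kx hkx g g hg hgs hg hgs), hr g hg hgs, sub_self]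
  have hD := polarisation (fun z => ky z - kx z) hDc hDeven hQ
  have hz := congrFun hD z
  simp only [Pi.zero_apply, sub_eq_zero] at hz
  exact hz

open RadialLift in
/-- **Norm reduction.** Planar equal-radius moves and the coordinate transpositions `(1 2)`,
`(1 3)` bring every vector to `‖v‖ e₀`. -/
theorem RadialLift.norm_reduction (K : EuclideanSpace ℝ (Fin 4) → ℝ)
    (hswap12 : ∀ a b c d : ℝ,
      K (WithLp.toLp 2 ![a, c, b, d]) = K (WithLp.toLp 2 ![a, b, c, d]))
    (hswap13 : ∀ a b c d : ℝ,
      K (WithLp.toLp 2 ![a, d, c, b]) = K (WithLp.toLp 2 ![a, b, c, d]))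
    (planar : ∀ x y : ℝ × ℝ, x ≠ 0 → x.1 ^ 2 + x.2 ^ 2 = y.1 ^ 2 + y.2 ^ 2 → ∀ z : ℝ × ℝ,
      K (WithLp.toLp 2 ![y.1, y.2, z.1, z.2]) = K (WithLp.toLp 2 ![x.1, x.2, z.1, z.2]))
    (v : EuclideanSpace ℝ (Fin 4)) :
    K v = K (WithLp.toLp 2 ![‖v‖, 0, 0, 0]) := by
  -- radial move in the `(0,1)` coordinate plane
  have move : ∀ a b c d : ℝ,
      K (WithLp.toLp 2 ![a, b, c, d]) = K (WithLp.toLp 2 ![√(a ^ 2 + b ^ 2), 0, c, d]) := by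
    intro a b c d
    rcases eq_or_ne ((a, b) : ℝ × ℝ) 0 with hab | hab
    · obtain ⟨rfl, rfl⟩ := Prod.mk_eq_zero.1 hab
      simp
    · have hr : (a, b).1 ^ 2 + (a, b).2 ^ 2 =
          (√(a ^ 2 + b ^ 2), (0 : ℝ)).1 ^ 2 + (√(a ^ 2 + b ^ 2), (0 : ℝ)).2 ^ 2 := by
        show a ^ 2 + b ^ 2 = √(a ^ 2 + b ^ 2) ^ 2 + 0 ^ 2
        rw [Real.sq_sqrt (by positivity)]
        ring
      exact (planar (a, b) (√(a ^ 2 + b ^ 2), 0) hab hr (c, d)).symm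
  obtain ⟨a, b, c, d, rfl⟩ : ∃ a b c d : ℝ, v = WithLp.toLp 2 ![a, b, c, d] :=
    ⟨v 0, v 1, v 2, v 3, by ext i; fin_cases i <;> simp⟩
  have hab : (0 : ℝ) ≤ a ^ 2 + b ^ 2 := by positivity
  have habc : (0 : ℝ) ≤ a ^ 2 + b ^ 2 + c ^ 2 := by positivity
  have hnorm : ‖(WithLp.toLp 2 ![a, b, c, d] : EuclideanSpace ℝ (Fin 4))‖ =
      √((√((√(a ^ 2 + b ^ 2)) ^ 2 + c ^ 2)) ^ 2 + d ^ 2) := by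
    rw [Real.sq_sqrt hab, Real.sq_sqrt habc, EuclideanSpace.norm_eq, Fin.sum_univ_four]
    simp only [Matrix.cons_val_zero, Matrix.cons_val_one, Matrix.head_cons,
      Matrix.cons_val_two, Matrix.tail_cons, Matrix.cons_val_three, Real.norm_eq_abs, sq_abs]
  calc K (WithLp.toLp 2 ![a, b, c, d])
      = K (WithLp.toLp 2 ![√(a ^ 2 + b ^ 2), 0, c, d]) := move a b c d
    _ = K (WithLp.toLp 2 ![√(a ^ 2 + b ^ 2), c, 0, d]) := hswap12 _ c 0 d
    _ = K (WithLp.toLp 2 ![√((√(a ^ 2 + b ^ 2)) ^ 2 + c ^ 2), 0, 0, d]) := move _ c 0 d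
    _ = K (WithLp.toLp 2 ![√((√(a ^ 2 + b ^ 2)) ^ 2 + c ^ 2), d, 0, 0]) := hswap13 _ d 0 0
    _ = K (WithLp.toLp 2 ![√((√((√(a ^ 2 + b ^ 2)) ^ 2 + c ^ 2)) ^ 2 + d ^ 2), 0, 0, 0]) :=
        move _ d 0 0
    _ = K (WithLp.toLp 2 ![‖(WithLp.toLp 2 ![a, b, c, d] : EuclideanSpace ℝ (Fin 4))‖,
          0, 0, 0]) := by rw [hnorm]

/-- **Stub 4 · radial lift** (polarisation + norm reduction). If every transverse
autocorrelation smearing of `K` takes equal values at planar points of equal radius, then `K` is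
invariant under every linear isometry: (i) POLARISATION — for planar `x ≠ 0`, `y` of equal radius,
`D(z) = K(y₁,y₂,z) - K(x₁,x₂,z)` is continuous and even in `z` (`(x₂,x₃) ↦ (-x₂,-x₃) ∈ W(B₄)`), the
symmetric bilinear form `(g,h) ↦ ∫∫ g h' D(w-w')` has vanishing quadratic form on `C_c`, hence vanishes,
hence `D = 0`; (ii) NORM REDUCTION — equal-radius moves in the `(0,1)`-plane conjugated by the
permutations `(1 2)`, `(1 3) ∈ W(B₄)` bring any `x` to `‖x‖ e₀`, so `K x = K (‖x‖ e₀)`, and isometries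
preserve the norm. -/
theorem stub_radialLift (K : EuclideanSpace ℝ (Fin 4) → ℝ)
    (hc : ContinuousOn K {x | x ≠ 0})
    (hW : ∀ R : EuclideanSpace ℝ (Fin 4) ≃ₗᵢ[ℝ] EuclideanSpace ℝ (Fin 4),
      (∀ i : Fin 4, ∃ j : Fin 4, R (EuclideanSpace.single i 1) = EuclideanSpace.single j 1 ∨
        R (EuclideanSpace.single i 1) = -EuclideanSpace.single j 1) →
      ∀ x : EuclideanSpace ℝ (Fin 4), K (R x) = K x)
    (hrad : ∀ h : ℝ × ℝ → ℝ, Continuous h → HasCompactSupport h →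
      ∀ x y : ℝ × ℝ, x ≠ 0 → x.1 ^ 2 + x.2 ^ 2 = y.1 ^ 2 + y.2 ^ 2 →
        (∫ w : ℝ × ℝ, ∫ w' : ℝ × ℝ,
            h w * h w' * K (WithLp.toLp 2 ![x.1, x.2, (w - w').1, (w - w').2])) =
          ∫ w : ℝ × ℝ, ∫ w' : ℝ × ℝ,
            h w * h w' * K (WithLp.toLp 2 ![y.1, y.2, (w - w').1, (w - w').2])) :
    ∀ (R : EuclideanSpace ℝ (Fin 4) ≃ₗᵢ[ℝ] EuclideanSpace ℝ (Fin 4)) (x : EuclideanSpace ℝ (Fin 4)),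
      K (R x) = K x := by
  -- the three signed permutations we need
  have hflip : ∀ a b c d : ℝ,
      K (WithLp.toLp 2 ![a, b, -c, -d]) = K (WithLp.toLp 2 ![a, b, c, d]) := by
    obtain ⟨F, hF, hFapp⟩ := RadialLift.exists_flip23
    intro a b c d
    rw [← hFapp, hW F hF]
  have hperm : ∀ (e : Fin 4 ≃ Fin 4) (v : EuclideanSpace ℝ (Fin 4)),
      K (LinearIsometryEquiv.piLpCongrLeft 2 ℝ ℝ e v) = K v :=
    fun e v => hW _ (RadialLift.isSignedPerm_perm e) v
  have hswap12 : ∀ a b c d : ℝ,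
      K (WithLp.toLp 2 ![a, c, b, d]) = K (WithLp.toLp 2 ![a, b, c, d]) := by
    intro a b c d
    rw [← hperm (Equiv.swap 1 2) (WithLp.toLp 2 ![a, b, c, d])]
    congr 1
    ext i
    fin_cases i <;> simp [RadialLift.perm_apply, Equiv.swap_apply_def]
  have hswap13 : ∀ a b c d : ℝ,
      K (WithLp.toLp 2 ![a, d, c, b]) = K (WithLp.toLp 2 ![a, b, c, d]) := by
    intro a b c d
    rw [← hperm (Equiv.swap 1 3) (WithLp.toLp 2 ![a, b, c, d])]
    congr 1
    ext i
    fin_cases i <;> simp [RadialLift.perm_apply, Equiv.swap_apply_def]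
  have planar := RadialLift.planar_of_smear K hc hflip hrad
  intro R x
  rw [RadialLift.norm_reduction K hswap12 hswap13 planar (R x),
    RadialLift.norm_reduction K hswap12 hswap13 planar x, LinearIsometryEquiv.norm_map]

end Summit.QuantumFields.YangMills.Cruxes.ShellRigidity.TransverseSmearingPlanarThreshold
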